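import Summits.QuantumFields.YangMills.Theorems.BalabanLadderIRcofEquipartitionSeamSliceKernelChain
import Literature.MathematicalPhysics.QuantumFieldTheory.WilsonFinTorusSliceKernel
import Summits.QuantumFields.YangMills.Theorems.BalabanLadderIRcofEquipartitionSeamKernelDefs
import HarnessLib

/-!
# Crux `IRcof` (stmt-QuantumFields-26930) · line `equipartition_seam` (row 47) · located stub L `SpectralDict.SliceRealisationV` — helper:
# the gauge-averaged SLICE KERNEL of a GENERAL weight, F3 ∕ 7 — §6 slab chain → path kernel (the abstract half of (W)'s domination `|Bk| ≤ nrm A · pathK`), §7 time-FIRST slicing of the `Fin`-box (`assembleZero`, `map_assembleZero_eq_pi`, plaquettes layer by layer, electric ∕ magnetic plane split)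

SOURCE OF RECORD: `Cruxes/IRcof/Lines/equipartition_seam_SliceKernel.lean` rev 9 (crux write 148dcb46cebb, 2172 l.; author ideator ym-ir-idea-22 g7; critic ym-ir-crit-3 g5 TYPEREADs CLEAN of revs 1–6 (bus l.1748 ∕ 1758 ∕ 1768 ∕ 1775 ∕ 1780), placement ruling H1 ∕ H2 (l.1748: §1 → Literature = lit-4 L34 p694639; §2 onward → ≤ 400-line Theorems files) — split VERBATIM along its §§ by LEAD prover ym-ir-line-ab-p1 g8 on the ideator's LAND-ASK H2 (bus l.1786 ∕ l.1789: files F1–F7, each importing the previous).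

HONEST FRAMING.  Elementary measure theory ∕ Fubini on compact groups (Lüscher 1977 ∕ Osterwalder–Seiler 1978 transfer-matrix positivity, weight-generic); proves NO located stub of row 47 by itself (S1, S3ʷ, T, L, N, S5ᵛ open); row 47 class PWP, mechanism 0, width 0; `IRcof` ∕ `IR` 0∕1; the Yang–Mills mass gap (Clay) is NOT proved by anything in this tree; R4 closes only the conditional finite-𝕋⁴ rung `BalabanLadder.UV`.
-/

noncomputable section

open MeasureTheory ProbabilityTheory Finset Filter Function
open scoped BigOperators

namespace Summit.QuantumFields.YangMills.Cruxes.IRcof.EquipartitionSeam.SliceKernel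

open Literature.Analysis.Matrix (IsPosDefKernel isPosDefKernel_const IsPosDefKernel.integral_prod_nonneg_of_measurable)
open Literature.MathematicalPhysics.QuantumFieldTheory (haarProbability integral_integral_fibreAverage_nonneg
  integrable_of_abs_le_one abs_mul_mul_le_one abs_integral_le_one)



/-! ## §6 Slab chain → path kernel (the abstract half of (W)'s domination `|Bk| ≤ nrm A · pathK`)

The species block of L's (W) clause is `Bk u y = a u · (∫ F · (layered slab weight) d(inner slices, slab layers)) · a y`
on a slab of `r + 1` bonds with end slices `u, y`, where `F = A.F ∘ π ∘ (links of the slab)`, `|F| ≤ nrm A`.  With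
`F ≡ 1` the same expression is the PATH KERNEL `pathK μ K r u y = ∫ ∏_{b ≤ r} K (chain b) (chain (b+1)) dμ^{⊗r}`,
`chain = Fin.cons u (Fin.snoc v y)`, of `K = sandKernel a` — `integral_slab_eq_integral_pathChain`, stated with the body
of `SpectralDict.pathK` VERBATIM (so it matches by `rfl` once PART 3 `…SpectralDictKernelCalc` lands) — and the
domination is `abs_mul_integral_mul_mul_le` (non-negative `a` and slab weight, `|F| ≤ nrm`). -/

section Slab

variable {P Λ H : Type*} [Fintype P] [Fintype Λ] [Group H] [TopologicalSpace H] [IsTopologicalGroup H]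
  [CompactSpace H] [MeasurableSpace H] [BorelSpace H] (src tgt : Λ → P) (w : H → ℝ) (a : (Λ → H) → ℝ)

omit [Fintype P] [Fintype Λ] [Group H] [TopologicalSpace H] [IsTopologicalGroup H] [CompactSpace H]
  [MeasurableSpace H] [BorelSpace H] in
/-- End-point bookkeeping on a chain `Fin.cons u (Fin.snoc v y)`: the bond-wise product of
`x (left end) · x (right end)` is `x u · x y · ∏_{inner} (x vᵢ)²`. -/
theorem prod_chain_castSucc_mul_succ {X : Type*} (x : X → ℝ) (r : ℕ) (u y : X) (v : Fin r → X) :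
    ∏ b : Fin (r + 1), (x ((Fin.cons u (Fin.snoc v y) : Fin (r + 2) → X) (Fin.castSucc b)) *
        x ((Fin.cons u (Fin.snoc v y) : Fin (r + 2) → X) (Fin.succ b))) =
      x u * x y * ∏ i, x (v i) ^ 2 := by
  have h1 : ∀ i : Fin r, (Fin.cons u (Fin.snoc v y) : Fin (r + 2) → X) i.succ.castSucc = v i := fun i => by
    rw [← Fin.succ_castSucc, Fin.cons_succ, Fin.snoc_castSucc]
  have h2 : (Fin.cons u (Fin.snoc v y) : Fin (r + 2) → X) (Fin.last r).succ = y := by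
    rw [Fin.cons_succ, Fin.snoc_last]
  have h0 : (Fin.cons u (Fin.snoc v y) : Fin (r + 2) → X) (Fin.castSucc 0) = u := rfl
  rw [Finset.prod_mul_distrib, Fin.prod_univ_succ, Fin.prod_univ_castSucc, h0, h2]
  simp_rw [Fin.succ_castSucc, h1]
  rw [Finset.prod_pow, sq]
  ring

omit [Fintype P] [Fintype Λ] [Group H] [TopologicalSpace H] [IsTopologicalGroup H] [CompactSpace H]
  [BorelSpace H] in
/-- The chain `v ↦ Fin.cons u (Fin.snoc v y)` is measurable. -/
theorem measurable_chain (r : ℕ) (u y : Λ → H) :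
    Measurable fun v : Fin r → Λ → H => (Fin.cons u (Fin.snoc v y) : Fin (r + 2) → Λ → H) := by
  refine measurable_pi_iff.mpr fun j => ?_
  refine Fin.cases ?_ (fun k => ?_) j
  · simp only [Fin.cons_zero]; exact measurable_const
  · simp only [Fin.cons_succ]
    refine Fin.lastCases ?_ (fun i => ?_) k
    · simp only [Fin.snoc_last]; exact measurable_const
    · simp only [Fin.snoc_castSucc]; exact measurable_pi_apply i

omit [Fintype P] [Fintype Λ] [Group H] [TopologicalSpace H] [IsTopologicalGroup H] [CompactSpace H]
  [MeasurableSpace H] [BorelSpace H] in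
/-- **Domination of an observable insertion**: `|a u · (∫ F · G) · a y| ≤ nrm · (a u · (∫ G) · a y)` for `0 ≤ a u, a y`,
`0 ≤ G`, `|F| ≤ nrm` (the shape of `|Bk| ≤ nrm A · pathK`). -/
theorem abs_mul_integral_mul_mul_le {Ω : Type*} [MeasurableSpace Ω] (ν : Measure Ω) {F G : Ω → ℝ} {nrm au ay : ℝ}
    (hau : 0 ≤ au) (hay : 0 ≤ ay) (hG : ∀ ω, 0 ≤ G ω) (hF : ∀ ω, |F ω| ≤ nrm) (hGi : Integrable G ν)
    (hFGi : Integrable (fun ω => F ω * G ω) ν) :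
    |au * (∫ ω, F ω * G ω ∂ν) * ay| ≤ nrm * (au * (∫ ω, G ω ∂ν) * ay) := by
  have hnrm : ∀ ω, F ω * G ω ≤ nrm * G ω := fun ω =>
    (le_abs_self _).trans (by rw [abs_mul, abs_of_nonneg (hG ω)]; exact mul_le_mul_of_nonneg_right (hF ω) (hG ω))
  have hnrm' : ∀ ω, -(nrm * G ω) ≤ F ω * G ω := fun ω => by
    have := (neg_abs_le _).trans (le_refl (F ω * G ω))
    have h2 : |F ω * G ω| ≤ nrm * G ω := by
      rw [abs_mul, abs_of_nonneg (hG ω)]; exact mul_le_mul_of_nonneg_right (hF ω) (hG ω)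
    linarith
  have hup : ∫ ω, F ω * G ω ∂ν ≤ nrm * ∫ ω, G ω ∂ν := by
    rw [← integral_const_mul]
    exact integral_mono hFGi (hGi.const_mul nrm) hnrm
  have hlo : -(nrm * ∫ ω, G ω ∂ν) ≤ ∫ ω, F ω * G ω ∂ν := by
    rw [← integral_const_mul, ← integral_neg]
    exact integral_mono (hGi.const_mul nrm).neg hFGi hnrm'
  rw [abs_mul, abs_mul, abs_of_nonneg hau, abs_of_nonneg hay]
  have hI : |∫ ω, F ω * G ω ∂ν| ≤ nrm * ∫ ω, G ω ∂ν := abs_le.mpr ⟨hlo, hup⟩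
  calc au * |∫ ω, F ω * G ω ∂ν| * ay ≤ au * (nrm * ∫ ω, G ω ∂ν) * ay :=
        mul_le_mul_of_nonneg_right (mul_le_mul_of_nonneg_left hI hau) hay
    _ = nrm * (au * (∫ ω, G ω ∂ν) * ay) := by ring

variable [SecondCountableTopology H]
set_option maxHeartbeats 400000 in
/-- **SLAB CHAIN → PATH KERNEL.**  For fixed end slices `u, y` and `r` inner slices, integrating the layered slab weight
`(∏ᵢ a(vᵢ)²) · ∏_{b ≤ r} tempKernel (chain b) (g b) (chain (b+1))` over the inner slices and the `r + 1` temporal layers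
and sandwiching with `a u`, `a y` gives the path kernel of `K = sandKernel a`:
`a u · (∫ …) · a y = ∫ ∏_{b ≤ r} K (chain b) (chain (b+1)) dμ^{⊗r}` — the right-hand side is the body of
`SpectralDict.pathK μ K r u y`. [folklore; cite: Luscher1977] -/
theorem integral_slab_eq_integral_pathChain (hw : Continuous w) (hw0 : ∀ h, 0 ≤ w h) {Cw : ℝ}
    (hwC : ∀ h, w h ≤ Cw) (ha : Measurable a) {Ca : ℝ} (haC : ∀ V, |a V| ≤ Ca) (r : ℕ) (u y : Λ → H) :
    a u * (∫ q : (Fin r → Λ → H) × (Fin (r + 1) → P → H),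
        (∏ i, a (q.1 i) ^ 2) *
          ∏ b : Fin (r + 1), tempKernel src tgt w
            ((Fin.cons u (Fin.snoc q.1 y) : Fin (r + 2) → Λ → H) (Fin.castSucc b)) (q.2 b)
            ((Fin.cons u (Fin.snoc q.1 y) : Fin (r + 2) → Λ → H) (Fin.succ b))
      ∂((Measure.pi fun _ => Measure.pi fun _ : Λ => haarProbability H).prod
          (Measure.pi fun _ => Measure.pi fun _ : P => haarProbability H))) * a y =
    ∫ v : Fin r → Λ → H, ∏ i : Fin (r + 1),
        sandKernel src tgt w a ((Fin.cons u (Fin.snoc v y) : Fin (r + 2) → Λ → H) (Fin.castSucc i))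
          ((Fin.cons u (Fin.snoc v y) : Fin (r + 2) → Λ → H) (Fin.succ i))
      ∂(Measure.pi fun _ => Measure.pi fun _ : Λ => haarProbability H) := by
  -- measurability and a uniform bound of the layered slab weight
  have hch : Measurable fun q : (Fin r → Λ → H) × (Fin (r + 1) → P → H) =>
      (Fin.cons u (Fin.snoc q.1 y) : Fin (r + 2) → Λ → H) := (measurable_chain r u y).comp measurable_fst
  have hchj : ∀ j : Fin (r + 2), Measurable fun q : (Fin r → Λ → H) × (Fin (r + 1) → P → H) =>
      (Fin.cons u (Fin.snoc q.1 y) : Fin (r + 2) → Λ → H) j := fun j => (measurable_pi_apply j).comp hch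
  have hq1 : ∀ i : Fin r, Measurable fun q : (Fin r → Λ → H) × (Fin (r + 1) → P → H) => q.1 i :=
    fun i => (measurable_pi_apply i).comp measurable_fst
  have hq2 : ∀ b : Fin (r + 1), Measurable fun q : (Fin r → Λ → H) × (Fin (r + 1) → P → H) => q.2 b :=
    fun b => (measurable_pi_apply b).comp measurable_snd
  have hFm : Measurable fun q : (Fin r → Λ → H) × (Fin (r + 1) → P → H) =>
      (∏ i, a (q.1 i) ^ 2) *
        ∏ b : Fin (r + 1), tempKernel src tgt w
          ((Fin.cons u (Fin.snoc q.1 y) : Fin (r + 2) → Λ → H) (Fin.castSucc b)) (q.2 b)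
          ((Fin.cons u (Fin.snoc q.1 y) : Fin (r + 2) → Λ → H) (Fin.succ b)) :=
    (Finset.measurable_prod _ fun i _ => (ha.comp (hq1 i)).pow_const 2).mul
      (Finset.measurable_prod _ fun b _ => (continuous_tempKernel src tgt w hw).measurable.comp
        ((hchj (Fin.castSucc b)).prodMk ((hq2 b).prodMk (hchj (Fin.succ b)))))
  have hCw : 0 ≤ Cw ^ Fintype.card Λ :=
    (tempKernel_nonneg src tgt w hw0 1 1 1).trans (tempKernel_le_pow src tgt w hw0 hwC 1 1 1)
  have hFb : ∀ q : (Fin r → Λ → H) × (Fin (r + 1) → P → H),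
      ‖(∏ i, a (q.1 i) ^ 2) *
        ∏ b : Fin (r + 1), tempKernel src tgt w
          ((Fin.cons u (Fin.snoc q.1 y) : Fin (r + 2) → Λ → H) (Fin.castSucc b)) (q.2 b)
          ((Fin.cons u (Fin.snoc q.1 y) : Fin (r + 2) → Λ → H) (Fin.succ b))‖ ≤
        (Ca ^ 2) ^ r * (Cw ^ Fintype.card Λ) ^ (r + 1) := by
    intro q
    rw [Real.norm_eq_abs, abs_mul, Finset.abs_prod, Finset.abs_prod]
    refine mul_le_mul ?_ ?_ (Finset.prod_nonneg fun _ _ => abs_nonneg _) (pow_nonneg (sq_nonneg _) _)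
    · calc ∏ i, |a (q.1 i) ^ 2| ≤ ∏ _i : Fin r, Ca ^ 2 :=
            Finset.prod_le_prod (fun _ _ => abs_nonneg _) fun i _ => by
              rw [abs_pow]; exact pow_le_pow_left₀ (abs_nonneg _) (haC _) 2
        _ = (Ca ^ 2) ^ r := by rw [Finset.prod_const, Finset.card_univ, Fintype.card_fin]
    · calc ∏ b : Fin (r + 1), |tempKernel src tgt w
              ((Fin.cons u (Fin.snoc q.1 y) : Fin (r + 2) → Λ → H) (Fin.castSucc b)) (q.2 b)
              ((Fin.cons u (Fin.snoc q.1 y) : Fin (r + 2) → Λ → H) (Fin.succ b))|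
            ≤ ∏ _b : Fin (r + 1), Cw ^ Fintype.card Λ :=
            Finset.prod_le_prod (fun _ _ => abs_nonneg _) fun b _ =>
              abs_tempKernel_le_pow src tgt w hw0 hwC _ _ _
        _ = (Cw ^ Fintype.card Λ) ^ (r + 1) := by rw [Finset.prod_const, Finset.card_univ, Fintype.card_fin]
  -- Fubini over (inner slices, slab layers), then integrate out the layers
  rw [integral_prod _ ((integrable_const _).mono' hFm.aestronglyMeasurable (Eventually.of_forall hFb))]
  have hinner : ∀ v : Fin r → Λ → H,
      ∫ g : Fin (r + 1) → P → H, (∏ i, a (v i) ^ 2) *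
          ∏ b : Fin (r + 1), tempKernel src tgt w
            ((Fin.cons u (Fin.snoc v y) : Fin (r + 2) → Λ → H) (Fin.castSucc b)) (g b)
            ((Fin.cons u (Fin.snoc v y) : Fin (r + 2) → Λ → H) (Fin.succ b))
        ∂(Measure.pi fun _ => Measure.pi fun _ : P => haarProbability H) =
      (∏ i, a (v i) ^ 2) * ∏ b : Fin (r + 1), avgKernel src tgt w
          ((Fin.cons u (Fin.snoc v y) : Fin (r + 2) → Λ → H) (Fin.castSucc b))
          ((Fin.cons u (Fin.snoc v y) : Fin (r + 2) → Λ → H) (Fin.succ b)) := fun v => by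
    rw [integral_const_mul, integral_prod_tempKernel_pi src tgt w]
  simp_rw [hinner]
  -- sandwich with the end factors and regroup `a²` bond-wise
  rw [← integral_const_mul, ← integral_mul_const]
  refine integral_congr_ae (Eventually.of_forall fun v => ?_)
  dsimp only
  simp only [sandKernel]
  have hsplit : ∏ i : Fin (r + 1), (a ((Fin.cons u (Fin.snoc v y) : Fin (r + 2) → Λ → H) (Fin.castSucc i)) *
      avgKernel src tgt w ((Fin.cons u (Fin.snoc v y) : Fin (r + 2) → Λ → H) (Fin.castSucc i))
        ((Fin.cons u (Fin.snoc v y) : Fin (r + 2) → Λ → H) (Fin.succ i)) *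
      a ((Fin.cons u (Fin.snoc v y) : Fin (r + 2) → Λ → H) (Fin.succ i))) =
      (∏ i : Fin (r + 1), avgKernel src tgt w ((Fin.cons u (Fin.snoc v y) : Fin (r + 2) → Λ → H) (Fin.castSucc i))
        ((Fin.cons u (Fin.snoc v y) : Fin (r + 2) → Λ → H) (Fin.succ i))) *
      ∏ i : Fin (r + 1), (a ((Fin.cons u (Fin.snoc v y) : Fin (r + 2) → Λ → H) (Fin.castSucc i)) *
        a ((Fin.cons u (Fin.snoc v y) : Fin (r + 2) → Λ → H) (Fin.succ i))) := by
    rw [← Finset.prod_mul_distrib]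
    exact Finset.prod_congr rfl fun i _ => by ring
  rw [hsplit, prod_chain_castSucc_mul_succ a r u y v]
  ring

end Slab


open Literature.MathematicalPhysics.QuantumFieldTheory
open Summit.QuantumFields.YangMills.Cruxes.IRcof.EquipartitionSeam.KernelCurrency (sectorTensor withEl secZ secW)
open Literature.MathematicalPhysics.QuantumLattice (torusLift torusEdge)

/-! ## §7 Time-FIRST slicing of the `Fin`-box (Summit convention: time = axis `0`)

The tree's `WilsonFinTorusSliceKernel.finTorusAssemble` slices along the LAST axis; `secZ`/`secW` (KernelDefs §A) put the
variable (time) extent on axis `0` and the electric planes are `(0, i+1)`.  Since `FinTorusSite m b₁ b₂ b₃ = Fin m × FinSpatialSite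
b₁ b₂ b₃` DEFINITIONALLY (`x.1` = time, `x.2` = spatial site), the time-first assembling needs no slicing bijection. -/

section AssembleZero

variable {m b₁ b₂ b₃ : ℕ} {G : Type*}

/-- **Time-first assembling** of a link configuration of the `Fin`-box `m × b₁ × b₂ × b₃` from spatial slices `V t` and temporal
links `E t`: `U((t,p), 0) = E t p`, `U((t,p), i+1) = V t (p, i)`. [folklore; cite: MontvayMunster1994, §3.2.6 (3.139)] -/
def assembleZero (VE : (Fin m → (FinSpatialSite b₁ b₂ b₃ × Fin 3 → G)) × (Fin m → (FinSpatialSite b₁ b₂ b₃ → G))) :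
    FinTorusSite m b₁ b₂ b₃ × Fin 4 → G :=
  fun l => Fin.cases (VE.2 l.1.1 l.1.2) (fun i : Fin 3 => VE.1 l.1.1 (l.1.2, i)) l.2

/-- Temporal links of the assembled configuration. -/
@[simp] theorem assembleZero_zero
    (VE : (Fin m → (FinSpatialSite b₁ b₂ b₃ × Fin 3 → G)) × (Fin m → (FinSpatialSite b₁ b₂ b₃ → G)))
    (x : FinTorusSite m b₁ b₂ b₃) : assembleZero VE (x, 0) = VE.2 x.1 x.2 := by
  simp only [assembleZero, Fin.cases_zero]

/-- Spatial links of the assembled configuration. -/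
@[simp] theorem assembleZero_succ
    (VE : (Fin m → (FinSpatialSite b₁ b₂ b₃ × Fin 3 → G)) × (Fin m → (FinSpatialSite b₁ b₂ b₃ → G)))
    (x : FinTorusSite m b₁ b₂ b₃) (i : Fin 3) : assembleZero VE (x, i.succ) = VE.1 x.1 (x.2, i) := by
  simp only [assembleZero, Fin.cases_succ]

/-- Time-first assembling is measurable. -/
theorem measurable_assembleZero [MeasurableSpace G] :
    Measurable (assembleZero :
      (Fin m → (FinSpatialSite b₁ b₂ b₃ × Fin 3 → G)) × (Fin m → (FinSpatialSite b₁ b₂ b₃ → G)) →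
        FinTorusSite m b₁ b₂ b₃ × Fin 4 → G) := by
  refine measurable_pi_lambda _ fun l => ?_
  obtain ⟨x, μ⟩ := l
  induction μ using Fin.cases with
  | zero =>
    simp only [assembleZero_zero]
    exact (measurable_pi_apply _).comp ((measurable_pi_apply _).comp measurable_snd)
  | succ i =>
    simp only [assembleZero_succ]
    exact (measurable_pi_apply _).comp ((measurable_pi_apply _).comp measurable_fst)

/-- Time-first assembling is continuous. -/
theorem continuous_assembleZero [TopologicalSpace G] :
    Continuous (assembleZero :
      (Fin m → (FinSpatialSite b₁ b₂ b₃ × Fin 3 → G)) × (Fin m → (FinSpatialSite b₁ b₂ b₃ → G)) →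
        FinTorusSite m b₁ b₂ b₃ × Fin 4 → G) := by
  refine continuous_pi fun l => ?_
  obtain ⟨x, μ⟩ := l
  induction μ using Fin.cases with
  | zero =>
    simp only [assembleZero_zero]
    exact (continuous_apply _).comp ((continuous_apply _).comp continuous_snd)
  | succ i =>
    simp only [assembleZero_succ]
    exact (continuous_apply _).comp ((continuous_apply _).comp continuous_fst)

/-- The preimage of a box of link sets under time-first assembling is a product of boxes of slices. -/
theorem preimage_assembleZero_pi (s : FinTorusSite m b₁ b₂ b₃ × Fin 4 → Set G) :
    (assembleZero :
      (Fin m → (FinSpatialSite b₁ b₂ b₃ × Fin 3 → G)) × (Fin m → (FinSpatialSite b₁ b₂ b₃ → G)) →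
        FinTorusSite m b₁ b₂ b₃ × Fin 4 → G) ⁻¹' Set.pi Set.univ s =
      (Set.pi Set.univ fun t : Fin m => Set.pi Set.univ fun l : FinSpatialSite b₁ b₂ b₃ × Fin 3 =>
          s ((t, l.1), l.2.succ)) ×ˢ
        (Set.pi Set.univ fun t : Fin m => Set.pi Set.univ fun p : FinSpatialSite b₁ b₂ b₃ => s ((t, p), 0)) := by
  ext VE
  simp only [Set.mem_preimage, Set.mem_pi, Set.mem_univ, true_implies, Set.mem_prod]
  constructor
  · intro h
    refine ⟨fun t l => ?_, fun t p => ?_⟩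
    · simpa using h ((t, l.1), l.2.succ)
    · simpa using h ((t, p), 0)
  · rintro ⟨h1, h2⟩ ⟨x, μ⟩
    induction μ using Fin.cases with
    | zero => simpa using h2 x.1 x.2
    | succ i => simpa using h1 x.1 (x.2, i)

/-- **The a-priori measure is the product of the slice measures** (time-first form of `map_finTorusAssemble_eq_pi`).
[cite: MontvayMunster1994, §3.2.6 (3.145)] -/
theorem map_assembleZero_eq_pi [MeasurableSpace G] (ν : Measure G) [SigmaFinite ν] :
    Measure.map (assembleZero :
      (Fin m → (FinSpatialSite b₁ b₂ b₃ × Fin 3 → G)) × (Fin m → (FinSpatialSite b₁ b₂ b₃ → G)) →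
        FinTorusSite m b₁ b₂ b₃ × Fin 4 → G)
      ((Measure.pi fun _ : Fin m => Measure.pi fun _ : FinSpatialSite b₁ b₂ b₃ × Fin 3 => ν).prod
        (Measure.pi fun _ : Fin m => Measure.pi fun _ : FinSpatialSite b₁ b₂ b₃ => ν)) =
      Measure.pi fun _ : FinTorusSite m b₁ b₂ b₃ × Fin 4 => ν := by
  symm
  refine Measure.pi_eq fun s hs => ?_
  rw [Measure.map_apply measurable_assembleZero (MeasurableSet.univ_pi hs), preimage_assembleZero_pi,
    Measure.prod_prod, Measure.pi_pi, Measure.pi_pi]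
  simp_rw [Measure.pi_pi]
  rw [Fintype.prod_prod_type]
  have h4 : ∀ x : FinTorusSite m b₁ b₂ b₃, ∏ μ : Fin 4, ν (s (x, μ)) =
      ν (s (x, 0)) * ∏ i : Fin 3, ν (s (x, i.succ)) := fun x => Fin.prod_univ_succ fun μ => ν (s (x, μ))
  simp_rw [h4]
  rw [Finset.prod_mul_distrib, Fintype.prod_prod_type, Fintype.prod_prod_type, mul_comm]
  congr 1
  refine Finset.prod_congr rfl fun t _ => ?_
  rw [Fintype.prod_prod_type]

/-- **Integrals over link configurations as integrals over (spatial slices, temporal links)**, time-first form. -/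
theorem integral_pi_eq_integral_assembleZero [MeasurableSpace G] (ν : Measure G) [SigmaFinite ν]
    {Φ : (FinTorusSite m b₁ b₂ b₃ × Fin 4 → G) → ℝ} (hΦ : Measurable Φ) :
    ∫ U, Φ U ∂(Measure.pi fun _ : FinTorusSite m b₁ b₂ b₃ × Fin 4 => ν) =
      ∫ VE, Φ (assembleZero VE)
        ∂((Measure.pi fun _ : Fin m => Measure.pi fun _ : FinSpatialSite b₁ b₂ b₃ × Fin 3 => ν).prod
          (Measure.pi fun _ : Fin m => Measure.pi fun _ : FinSpatialSite b₁ b₂ b₃ => ν)) := by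
  rw [← map_assembleZero_eq_pi ν, integral_map measurable_assembleZero.aemeasurable]
  rw [map_assembleZero_eq_pi]
  exact hΦ.aestronglyMeasurable

/-! ### Shifts and plaquettes of an assembled configuration -/

/-- Time shift of a site `(t, p)`: `(t+1, p)`. -/
theorem shift_zero_mk (t : Fin m) (p : FinSpatialSite b₁ b₂ b₃) :
    FinTorusSite.shift ((t, p) : FinTorusSite m b₁ b₂ b₃) 0 = (finRotate m t, p) := rfl

/-- Spatial shift of a site `(t, p)`: `(t, p + eᵢ)`. -/
theorem shift_succ_mk (t : Fin m) (p : FinSpatialSite b₁ b₂ b₃) (i : Fin 3) :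
    FinTorusSite.shift ((t, p) : FinTorusSite m b₁ b₂ b₃) i.succ = (t, p.shift i) := by
  fin_cases i <;> rfl

variable [Group G]

/-- **Temporal plaquette** `(0, i+1)` at `(t, p)` of the assembled configuration:
`E t p · V (t+1) (p,i) · (E t (p+eᵢ))⁻¹ · (V t (p,i))⁻¹`. -/
theorem finTorusPlaquette_assembleZero_zero_succ
    (VE : (Fin m → (FinSpatialSite b₁ b₂ b₃ × Fin 3 → G)) × (Fin m → (FinSpatialSite b₁ b₂ b₃ → G)))
    (t : Fin m) (p : FinSpatialSite b₁ b₂ b₃) (i : Fin 3) :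
    finTorusPlaquette (assembleZero VE) ((t, p) : FinTorusSite m b₁ b₂ b₃) 0 i.succ =
      VE.2 t p * VE.1 (finRotate m t) (p, i) * (VE.2 t (p.shift i))⁻¹ * (VE.1 t (p, i))⁻¹ := by
  simp only [finTorusPlaquette, shift_zero_mk, shift_succ_mk, assembleZero_zero, assembleZero_succ]

/-- **Spatial plaquette** `(i+1, j+1)` at `(t, p)` of the assembled configuration depends on the slice `V t` only:
`V t (p,i) · V t (p+eᵢ, j) · (V t (p+eⱼ, i))⁻¹ · (V t (p, j))⁻¹`. -/
theorem finTorusPlaquette_assembleZero_succ_succ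
    (VE : (Fin m → (FinSpatialSite b₁ b₂ b₃ × Fin 3 → G)) × (Fin m → (FinSpatialSite b₁ b₂ b₃ → G)))
    (t : Fin m) (p : FinSpatialSite b₁ b₂ b₃) (i j : Fin 3) :
    finTorusPlaquette (assembleZero VE) ((t, p) : FinTorusSite m b₁ b₂ b₃) i.succ j.succ =
      VE.1 t (p, i) * VE.1 t (p.shift i, j) * (VE.1 t (p.shift j, i))⁻¹ * (VE.1 t (p, j))⁻¹ := by
  simp only [finTorusPlaquette, shift_succ_mk, assembleZero_succ]

end AssembleZero

/-! ### The six planes: electric `(0, i+1)` and magnetic `(i+1, j+1)` -/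

section Planes

/-- The three MAGNETIC planes, indexed by ordered pairs of spatial directions. -/
abbrev SPlane : Type := {q : Fin 3 × Fin 3 // q.1 < q.2}

/-- A product over the six planes `μ < ν` of `Fin 4` in closed form. -/
theorem prod_plane_eq (g : Fin 4 → Fin 4 → ℝ) :
    ∏ q : Plane, g q.1.1 q.1.2 = (g 0 1 * g 0 2 * g 0 3) * (g 1 2 * g 1 3 * g 2 3) := by
  rw [← Finset.prod_subtype (Finset.univ.filter fun a : Fin 4 × Fin 4 => a.1 < a.2) (by simp)
    (fun a : Fin 4 × Fin 4 => g a.1 a.2), Finset.prod_filter, Fintype.prod_prod_type]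
  simp only [Fin.prod_univ_four, Fin.lt_def]
  norm_num
  ring

/-- A product over the three magnetic planes in closed form. -/
theorem prod_splane_eq (g : Fin 3 → Fin 3 → ℝ) : ∏ q : SPlane, g q.1.1 q.1.2 = g 0 1 * g 0 2 * g 1 2 := by
  rw [← Finset.prod_subtype (Finset.univ.filter fun a : Fin 3 × Fin 3 => a.1 < a.2) (by simp)
    (fun a : Fin 3 × Fin 3 => g a.1 a.2), Finset.prod_filter, Fintype.prod_prod_type]
  simp only [Fin.prod_univ_three, Fin.lt_def]
  norm_num

/-- **Electric ∕ magnetic split** of a product over the six planes: the three electric planes `(0, i+1)` and the three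
magnetic planes `(i+1, j+1)`, `i < j` in `Fin 3`. -/
theorem prod_plane_eq_electric_mul_magnetic (g : Fin 4 → Fin 4 → ℝ) :
    ∏ q : Plane, g q.1.1 q.1.2 = (∏ i : Fin 3, g 0 i.succ) * ∏ q : SPlane, g q.1.1.succ q.1.2.succ := by
  rw [prod_plane_eq, prod_splane_eq (fun i j => g i.succ j.succ), Fin.prod_univ_three]
  rfl

end Planes

end Summit.QuantumFields.YangMills.Cruxes.IRcof.EquipartitionSeam.SliceKernel

end
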